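import Summits.BirchSwinnertonDyer.BirchSwinnertonDyer.Theorems.BiquadraticEisensteinDescentEisensteinHeartFlatCMInertBadKPrimeSelmerTower
import Summits.BirchSwinnertonDyer.BirchSwinnertonDyer.Theorems.BiquadraticEisensteinDescentEisensteinHeartFlatCMInertBadKPrimeBaseChangeCriterion
import HarnessLib

set_option linter.dupNamespace false -- `Summit.BirchSwinnertonDyer.BirchSwinnertonDyer.Theorems.…` (summit = sub)
set_option autoImplicit false

/-!
# Crux `EisensteinHeartFlatCMInertBadKPrime` (stmt-BirchSwinnertonDyer-21341), line `hsieh-lambda`, layer 2 (V3), part 8: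
# preliminaries for the Shapiro datum — index-two subgroups of `Γ_K` against a `ℤ_p`-extension (`p` odd), and `E[p^∞]`
# (open stabilisers, `p`-primary, `2` invertible, `φ_* ∘ φ_* = d₀` for a coefficient endomorphism with `φ² = d₀`)

Route `BiquadraticEisensteinDescent` (cell `pub/bsd-wall`, width-prover seat `bsd-wall-cm-bed-w1` g5, D-0152 M1). Small inputs of the V3
assembly `…ShapiroDatum.lean`: §1 `eq_top_of_index_dvd_two`, `exists_mem_apply_eq_of_index_two` (`κ` is onto on an index-`2`
subgroup `U`, `p ≠ 2`), `exists_mem_kerSubgroup_not_mem` (`ker κ ⊄ U`), `mul_inv_mem_or_mem_of_index_two`; §2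
`isOpen_stabilizer_geomPrimaryTorsion`, `exists_pow_smul_geomPrimaryTorsion_eq_zero`, `two_nsmul_bijective_geomPrimaryTorsion`,
`resH1Hom_zsmul_eq`, `val_toZModPow_intCast_smul`, `resH1Hom_coeff_comp_self_eq_zsmul`.
THEOREMS ONLY (no definition, no named fact, no instance, no `sorry`); imports no `Theses` module; nothing about the crux or BSD is
asserted; BSD is not proved by any of this. Supports stmt-BirchSwinnertonDyer-21341 as a helper.

References: [Washington1997] §13.1; [SilvermanAEC2009] III.7, III.9, App. B.2; [Lang1990] Ch. 5 §1; [SerreLocalFields1979] VII.§5.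
-/

noncomputable section

open scoped Classical

namespace Summit.BirchSwinnertonDyer.BirchSwinnertonDyer.Theorems.BiquadraticEisensteinDescentEisensteinHeartFlatCMInertBadKPrimeTowerPrelim

open NumberField IsDedekindDomain Field PowerSeries
  Literature.NumberTheory.EllipticCurves Literature.NumberTheory.EllipticCurves.GreenbergSelmer
  Literature.NumberTheory.EllipticCurves.Module
  Literature.NumberTheory.EllipticCurves.IwasawaDual Literature.NumberTheory.GaloisRepresentations
  Summit.BirchSwinnertonDyer.Rank1Residual.X11b Summit.BirchSwinnertonDyer.Rank1Residual.X11b.AcSelmer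
  Summit.BirchSwinnertonDyer.BirchSwinnertonDyer.Theorems.BiquadraticEisensteinDescentEisensteinHeartFlatCMInertBadKPrimeIndexTwoRestriction
  Summit.BirchSwinnertonDyer.BirchSwinnertonDyer.Theorems.BiquadraticEisensteinDescentEisensteinHeartFlatCMInertBadKPrimeSelmerTower

universe u

/-! ## §1 Index-two subgroups of `Γ_K` versus a `ℤ_p`-extension, `p` odd -/

section IndexTwo

variable {K : Type u} [Field K] [NumberField K] {p : ℕ} [Fact p.Prime]

/-- A subgroup of `ℤ_p` (multiplicative notation) of index dividing `2` is everything when `p ≠ 2` (it contains all squares, and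
`2 ∈ ℤ_pˣ`). [cite: Washington1997, §13.1] -/
theorem eq_top_of_index_dvd_two (hp2 : p ≠ 2) (V : Subgroup (Multiplicative ℤ_[p])) (hV : V.index ∣ 2) : V = ⊤ := by
  rcases (Nat.dvd_prime Nat.prime_two).mp hV with h1 | h2
  · exact Subgroup.index_eq_one.mp h1
  · rw [eq_top_iff]
    intro y _
    obtain ⟨w, hw⟩ := BiquadraticEisensteinDescentEisensteinHeartFlatCMInertBadKPrimeBaseChangeCriterion.isUnit_two_padicInt hp2
    have hy : y = (Multiplicative.ofAdd ((↑w⁻¹ : ℤ_[p]) * Multiplicative.toAdd y)) ^ 2 := by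
      rw [← ofAdd_nsmul, nsmul_eq_mul, Nat.cast_ofNat, ← mul_assoc, ← hw, Units.mul_inv, one_mul, ofAdd_toAdd]
    rw [hy, ← h2]
    exact Subgroup.pow_index_mem V _

omit [NumberField K] in
/-- **`κ` is still onto on an index-two subgroup `U ≤ Γ_K`, `p` odd** (`U ∩ K_∞`-part: `Gal(K_∞/K) ≅ ℤ_p` has no quotient of
order `2`): `κ(U)` has index dividing `[Γ_K : U] = 2`. [cite: Washington1997, §13.1] -/
theorem exists_mem_apply_eq_of_index_two (hp2 : p ≠ 2) (κ : ZpExtension K p) (U : Subgroup (absoluteGaloisGroup K))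
    (hU2 : U.index = 2) (u : ℤ_[p]) : ∃ g ∈ U, κ g = Multiplicative.ofAdd u := by
  set f : absoluteGaloisGroup K →* Multiplicative ℤ_[p] := κ.toContinuousMonoidHom.toMonoidHom with hf
  have hidx : (U.map f).index ∣ 2 := hU2 ▸ Subgroup.index_map_dvd U κ.surjective
  have htop := eq_top_of_index_dvd_two hp2 _ hidx
  have hu : Multiplicative.ofAdd u ∈ U.map f := htop ▸ Subgroup.mem_top _
  obtain ⟨g, hgU, hg⟩ := Subgroup.mem_map.mp hu
  exact ⟨g, hgU, hg⟩

omit [NumberField K] in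
/-- For `U` of index `2` and `p` odd there is `c ∈ ker κ` outside `U` (`ker κ ⊄ U`: a lift to `U` of `κ a`, `a ∉ U`).
[cite: Washington1997, §13.1] -/
theorem exists_mem_kerSubgroup_not_mem (hp2 : p ≠ 2) (κ : ZpExtension K p) (U : Subgroup (absoluteGaloisGroup K))
    (hU2 : U.index = 2) : ∃ c ∈ κ.kerSubgroup, c ∉ U := by
  obtain ⟨a, ha⟩ := Subgroup.index_eq_two_iff.mp hU2
  have haU : a ∉ U := by
    have h1 := ha 1
    rw [one_mul] at h1
    rcases h1 with ⟨_, h⟩ | ⟨_, h⟩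
    · exact (h U.one_mem).elim
    · exact h
  obtain ⟨g, hgU, hg⟩ := exists_mem_apply_eq_of_index_two hp2 κ U hU2 (Multiplicative.toAdd (κ a))
  refine ⟨g⁻¹ * a, ?_, fun h ↦ haU ?_⟩
  · rw [ZpExtension.mem_kerSubgroup, map_mul, map_inv, hg, ofAdd_toAdd, inv_mul_cancel]
  · simpa using U.mul_mem hgU h

omit [NumberField K] [Fact p.Prime] in
/-- In an index-two situation `H′ ∩ H = U ∩ H`: every `b ∈ H` lies in `H′` or in `H′ c` for `c ∈ H ∖ U`. [folklore] -/
theorem mul_inv_mem_or_mem_of_index_two {H H' U : Subgroup (absoluteGaloisGroup K)} (hU2 : U.index = 2)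
    (hH' : ∀ x ∈ H, x ∈ H' ↔ x ∈ U) {c : absoluteGaloisGroup K} (hc : c ∈ H) (hcU : c ∉ U) :
    ∀ b ∈ H, b * c⁻¹ ∈ H' ∨ b ∈ H' := fun b hb ↦ by
  by_cases hbU : b ∈ U
  · exact Or.inr ((hH' b hb).2 hbU)
  · refine Or.inl ((hH' _ (H.mul_mem hb (H.inv_mem hc))).2 ?_)
    rw [Subgroup.mul_mem_iff_of_index_two hU2]
    exact ⟨fun h ↦ (hbU h).elim, fun h ↦ (hcU (by simpa using h)).elim⟩

end IndexTwo

/-! ## §2 The curve's `p`-primary torsion: open stabilisers, `p`-primary, `2` invertible for `p` odd -/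

section Torsion

variable {K : Type u} [Field K] [NumberField K] (E : WeierstrassCurve K) (p : ℕ) [Fact p.Prime]

omit [NumberField K] [Fact p.Prime] in
/-- Points of `E[p^∞]` have open stabilisers in `Γ_K` (the tree's `isOpen_stabilizer_point_holds`). [cite: SilvermanAEC2009, App. B.2] -/
theorem isOpen_stabilizer_geomPrimaryTorsion (m : E.geomPrimaryTorsion p) :
    IsOpen (MulAction.stabilizer (absoluteGaloisGroup K) m : Set (absoluteGaloisGroup K)) := by
  have hm : (MulAction.stabilizer (absoluteGaloisGroup K) m : Set (absoluteGaloisGroup K)) =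
      MulAction.stabilizer (absoluteGaloisGroup K) (m : E.geomPoints) := by
    ext τ
    rw [SetLike.mem_coe, SetLike.mem_coe, MulAction.mem_stabilizer_iff, MulAction.mem_stabilizer_iff]
    exact ⟨fun h ↦ by rw [← primaryComponent.coe_smul, h], fun h ↦ Subtype.ext (by rw [primaryComponent.coe_smul]; exact h)⟩
  rw [hm]
  exact E.isOpen_stabilizer_point_holds (m : E.geomPoints)

omit [NumberField K] [Fact p.Prime] in
/-- `E[p^∞]` is `p`-primary. [folklore] -/
theorem exists_pow_smul_geomPrimaryTorsion_eq_zero (m : E.geomPrimaryTorsion p) : ∃ k : ℕ, p ^ k • m = 0 := by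
  obtain ⟨k, hk⟩ := m.2
  exact ⟨k, Subtype.ext (by rw [AddSubgroupClass.coe_nsmul]; exact hk)⟩

omit [NumberField K] in
/-- For `p` odd, `2` is invertible on `E[p^∞]`. [folklore] -/
theorem two_nsmul_bijective_geomPrimaryTorsion (hp2 : p ≠ 2) :
    Function.Bijective fun m : E.geomPrimaryTorsion p ↦ (2 : ℕ) • m :=
  nsmul_bijective_of_isPrimary (exists_pow_smul_geomPrimaryTorsion_eq_zero E p)
    ((Nat.coprime_primes Nat.prime_two (Fact.out : p.Prime)).2 (Ne.symm hp2))

omit [NumberField K] [Fact p.Prime] in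
/-- The map induced on `H¹(B, M)` by the coefficient map `m ↦ z • m` (`z ∈ ℤ`) is multiplication by `z`. [folklore] -/
theorem resH1Hom_zsmul_eq {G : Type u} [Group G] [TopologicalSpace G] [IsTopologicalGroup G] (M : Type u) [AddCommGroup M]
    [DistribMulAction G M] [TopologicalSpace M] [DiscreteTopology M] (B : Subgroup G) (z : ℤ)
    (hz : ∀ (g : B) (m : M), DistribSMul.toAddMonoidHom M z (ContinuousMonoidHom.id B g • m) = g • DistribSMul.toAddMonoidHom M z m)
    (x : subgroupH1 B M) : resH1Hom (ContinuousMonoidHom.id B) (DistribSMul.toAddMonoidHom M z) hz x = z • x := by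
  obtain ⟨f, rfl⟩ := oneCocycleClass_surjective _ x
  rw [resH1Hom_oneCocycleClass]
  have e : contOneCocycles.pullback (ContinuousMonoidHom.id B)
      (resHomOfEquivariant (ContinuousMonoidHom.id B) (DistribSMul.toAddMonoidHom M z) hz) f = z • f := by
    apply Subtype.ext
    ext g
    rfl
  rw [e]
  exact (oneCocycleClass_smul _ z f).trans (int_smul_eq_zsmul _ z _)

omit [NumberField K] in
/-- Constants of `Λ` that are INTEGERS act on `p^k`-torsion values as the integer: `(z mod p^k).val • a = z • a` for `p^k • a = 0`.
[cite: Lang1990, Ch. 5 §1] -/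
theorem val_toZModPow_intCast_smul {A : Type*} [AddCommGroup A] (k : ℕ) (z : ℤ) (a : A) (ha : p ^ k • a = 0) :
    (PadicInt.toZModPow k (z : ℤ_[p])).val • a = z • a := by
  haveI : NeZero (p ^ k) := ⟨pow_ne_zero _ (Fact.out : p.Prime).ne_zero⟩
  rw [map_intCast]
  have hv : (((z : ZMod (p ^ k)).val : ℤ)) = z % ((p ^ k : ℕ) : ℤ) := ZMod.val_intCast z
  have hn : ((p ^ k : ℕ) : ℤ) • a = 0 := by rw [natCast_zsmul, ha]
  calc (z : ZMod (p ^ k)).val • a = (((z : ZMod (p ^ k)).val : ℤ)) • a := (natCast_zsmul a _).symm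
    _ = (z % ((p ^ k : ℕ) : ℤ)) • a := by rw [hv]
    _ = z • a := by
      rw [Int.emod_def, sub_zsmul, mul_comm, mul_zsmul, hn, zsmul_zero]
      simp only [neg_zero, add_zero]

omit [NumberField K] [Fact p.Prime] in
/-- **`φ_* ∘ φ_* = d₀`** on `H¹(H′, M)` when `φ ∘ φ = d₀` on `M` (`φ = [√d₀]`). [cite: SilvermanAEC2009, III.9 (CM)] -/
theorem resH1Hom_coeff_comp_self_eq_zsmul {G : Type u} [Group G] [TopologicalSpace G] [IsTopologicalGroup G] (M : Type u)
    [AddCommGroup M] [DistribMulAction G M] [TopologicalSpace M] [DiscreteTopology M] (B : Subgroup G) (φ : M →+ M)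
    (hφ : ∀ (g : B) (m : M), φ (g • m) = g • φ m) (d₀ : ℤ) (hφ2 : ∀ m, φ (φ m) = d₀ • m) (x : subgroupH1 B M) :
    resH1Hom (ContinuousMonoidHom.id B) φ hφ (resH1Hom (ContinuousMonoidHom.id B) φ hφ x) = d₀ • x := by
  have hz : ∀ (g : B) (m : M), DistribSMul.toAddMonoidHom M d₀ (ContinuousMonoidHom.id B g • m) =
      g • DistribSMul.toAddMonoidHom M d₀ m := fun g m ↦ smul_comm d₀ g m
  rw [← resH1Hom_zsmul_eq M B d₀ hz, resH1Hom_resH1Hom]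
  refine DFunLike.congr_fun (resH1Hom_congr (by ext; rfl) ?_ _ _) x
  ext m
  exact hφ2 m

end Torsion

end Summit.BirchSwinnertonDyer.BirchSwinnertonDyer.Theorems.BiquadraticEisensteinDescentEisensteinHeartFlatCMInertBadKPrimeTowerPrelim

end
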